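import Literature.Analysis.FluidPDE.TaoAveragedSobolev
import HarnessLib

/-!
# Tao's averaged Navier–Stokes blow-up: local cascade operators (Def. 3.1) and Theorems 3.2, 3.3

T. Tao, *Finite time blowup for an averaged three-dimensional Navier–Stokes equation*,
J. Amer. Math. Soc. **29** (2016), 601–674 = arXiv:1402.0290v3 (held as `paper:arxiv-1402.0290`;
all numbers are those of that text), §3, pp. 14–15: Definition 3.1 (local cascade operators,
(3.1)), Theorem 3.2 (local cascade operators are averaged Euler operators), Theorem 3.3
(blow-up for a local cascade equation, (3.2)–(3.3)), and the sentence between them: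
"Theorem 1.5 is then an immediate consequence of the following two results."

This is the top layer of the decomposition of Tao's Theorem 1.5, whose in-tree statement is
`Literature.Analysis.FluidPDE.Tao2016.averagedNS_blowup` (`TaoAveragedSobolev.lean`, over the
Hilbert space `L2C = L²(ℝ³; ℂ³)`, the class `MemH10df = H¹⁰_df(ℝ³)`, the pairing `⟨u, w⟩`,
averaging data `AveragingDatum` with their forms `𝒜.form = ⟨B̃(·,·), ·⟩`, and mild solutions
`IsMildSolutionFor`). Here:

* `basicCascadeForm`, `IsLocalCascadeForm` — Definition 3.1, the trilinear duality forms
  `⟨C(u,v), w⟩ = ∑_{n ∈ ℤ} (1+ε₀)^{5n/2} ⟨u, ψ_{1,n}⟩ ⟨v, ψ_{2,n}⟩ ⟨w, ψ_{3,n}⟩` with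
  `ψ_{i,n}(x) = (1+ε₀)^{3n/2} ψᵢ((1+ε₀)ⁿ x)` (`cascadeWavelet`, via the accepted `dil`) for Schwartz
  `ψᵢ` whose Fourier transforms are supported in the annulus `{1-2ε₀ ≤ |ξ| ≤ 1+2ε₀}`
  (`HasAnnularFourierSupport`), and their finite real linear combinations;
* `localCascade_isAveraged` — **Theorem 3.2** as a named fact;
* `localCascade_blowup` — **Theorem 3.3** as a named fact;
* `averagedNS_blowup_of_cascade` — **Theorem 1.5 ⇐ Theorem 3.2 + Theorem 3.3**, proved.

The remaining layers are: Thm 3.3 ⇐ Lemma 4.1 + Thm 4.2 (not yet in the tree), and the pure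
ODE layer Thm 4.2 ⇐ Thm 6.2 (`TaoAveragedODE.lean`, `TaoAveragedODEProofs.lean`).

## Design notes

* **Operators by duality, identities on the test class.** As in `TaoAveragedSobolev.lean`, a
  bilinear operator `H¹⁰_df × H¹⁰_df → (H¹⁰_df)*` *is* its trilinear form
  `(u, v, w) ↦ ⟨T(u,v), w⟩ : L2C → L2C → L2C → ℂ`, and statements about the operator are
  statements about the form on arguments in `H¹⁰_df` (values elsewhere are irrelevant: Tao's
  `C` is only defined on `H¹⁰_df`, p. 14). The series (3.1) converges absolutely for
  `u, v, w ∈ H¹⁰_df` (Tao, p. 14, by Plancherel); `tsum` junk `0` where it does not.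
* **The third slot is complexified.** The mild-solution identity (1.15)/(3.3) tests
  `⟨T(u(s),u(s)), e^{(t-s)Δ} w⟩` with `w ∈ H¹⁰_df`, and `e^{τΔ} w ∈ H¹⁰_df` (its `H¹⁰` bound and
  divergence-freeness are proved in `TaoAveragedSobolev.lean`; its — true — realness is not).
  To keep the assembly unconditional, the identities "`T` is given by (3.1)" (Def. 3.1) and
  "`⟨B̃(u,v), w⟩ = ⟨C(u,v), w⟩`" (Thm 3.2) are recorded for real `u, v ∈ H¹⁰_df` and `w` in the
  complexified class `MemH10dfC = H¹⁰_df ⊗ ℂ` (finite `H¹⁰` norm, divergence free, realness not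
  required). For real `u, v` both sides of either identity are `ℂ`-linear in `w` (absolutely
  convergent sum / expectation, Tao pp. 7 and 14), so the identity on `H¹⁰_df ⊗ ℂ ∋ w` is the
  `ℂ`-linear extension of the printed one on `H¹⁰_df ∋ w` — the complexification Tao himself
  uses throughout §3.1 (Definition 3.4). Symmetry and cancellation are stated on `H¹⁰_df` as
  printed.
* **Quantifiers.** Thm 3.2: "Let `ε₀ > 0` be a sufficiently small absolute constant" is an
  absolute threshold `ε₁ > 0` with the conclusion for all `0 < ε₀ ≤ ε₁`. Thm 3.3 holds for
  every `0 < ε₀ < 1`. In the assembly one takes `ε₀ = min ε₁ ½`.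

## References

* T. Tao, J. Amer. Math. Soc. 29 (2016), 601–674, arXiv:1402.0290v3, §3 (Def. 3.1, (3.1)–(3.3),
  Thms 3.2, 3.3, Def. 3.4), §1.1 (Thm 1.5). Key `Tao2016AveragedNS`.
-/

noncomputable section

open MeasureTheory Set Filter FourierTransform
open scoped ENNReal NNReal SchwartzMap

namespace Literature.Analysis.FluidPDE.Tao2016

/-- Local notation for physical / frequency space `ℝ³`. -/
local notation "ℝ³" => EuclideanSpace ℝ (Fin 3)

/-! ### The complexified class `H¹⁰_df ⊗ ℂ` -/

/-- Membership in the **complexified class `H¹⁰_df(ℝ³) ⊗ ℂ`** (Tao 2016, §3.1: the spaces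
`H¹⁰_df(ℝ³) ⊗ ℂ` on which the complexified operators act): finite `H¹⁰` norm and divergence
free in the distributional (Fourier) sense; `MemH10df` without the realness condition. [cite: Tao2016AveragedNS, §3.1 Def. 3.4] -/
def MemH10dfC (u : L2C) : Prop :=
  FunctionSpaces.eFourierSobolevNorm 10 u < ∞ ∧ IsFourierDivFree u

/-- `H¹⁰_df ⊆ H¹⁰_df ⊗ ℂ`. [folklore] -/
theorem MemH10df.memH10dfC {u : L2C} (h : MemH10df u) : MemH10dfC u :=
  ⟨h.1, h.2.2⟩

/-- The heat semigroup preserves `H¹⁰_df ⊗ ℂ` (`H^s`-contraction and preservation of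
divergence-freeness, both accepted). [folklore] -/
theorem MemH10dfC.heat {u : L2C} (h : MemH10dfC u) (τ : ℝ) : MemH10dfC (heat τ u) :=
  ⟨(eFourierSobolevNorm_heat_le 10 τ u).trans_lt h.1, h.2.heat τ⟩

/-- `0 ∈ H¹⁰_df ⊗ ℂ`. [folklore] -/
theorem memH10dfC_zero : MemH10dfC 0 :=
  memH10df_zero.memH10dfC

/-! ### Definition 3.1: local cascade operators -/

/-- The Fourier transform of the (real, vector-valued) Schwartz function `ψ` is **supported in
the annulus `{ξ : 1 - 2ε₀ ≤ |ξ| ≤ 1 + 2ε₀}`** (Tao 2016, Def. 3.1): the Fourier integral of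
`ψ` (componentwise, Tao's normalisation `ψ̂(ξ) = ∫ ψ(x) e^{-2πi x·ξ} dx` = Mathlib's `𝓕`)
vanishes at every `ξ` outside that closed annulus. [cite: Tao2016AveragedNS, Def. 3.1] -/
def HasAnnularFourierSupport (ε₀ : ℝ) (ψ : 𝓢(ℝ³, ℝ³)) : Prop :=
  ∀ ξ : ℝ³, ‖ξ‖ < 1 - 2 * ε₀ ∨ 1 + 2 * ε₀ < ‖ξ‖ →
    𝓕 (FunctionSpaces.EuclideanSpace.complexify ∘ ⇑ψ) ξ = 0

/-- The `L²`-rescaled wavelets `ψₙ(x) = (1+ε₀)^{3n/2} ψ((1+ε₀)ⁿ x)`, `n ∈ ℤ`, of Definition 3.1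
(and (4.1)), as elements of `L²(ℝ³; ℂ³)`: the accepted dilation `Dil_λ`, `λ = (1+ε₀)ⁿ`
(Tao (1.11)), of the class of `ψ`. [cite: Tao2016AveragedNS, Def. 3.1] -/
def cascadeWavelet (ε₀ : ℝ) (ψ : 𝓢(ℝ³, ℝ³)) (n : ℤ) : L2C :=
  dil ((1 + ε₀) ^ n) (schwartzL2 ψ)

/-- The trilinear duality form (3.1) of a **basic local cascade operator** with dyadic scale
parameter `ε₀` and profiles `ψ₁, ψ₂, ψ₃` (Tao 2016, Def. 3.1):
`⟨C(u,v), w⟩ = ∑_{n ∈ ℤ} (1+ε₀)^{5n/2} ⟨u, ψ_{1,n}⟩ ⟨v, ψ_{2,n}⟩ ⟨w, ψ_{3,n}⟩`.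
For `u, v, w ∈ H¹⁰_df` the series converges absolutely (Tao, p. 14); `tsum` junk `0`
otherwise. [cite: Tao2016AveragedNS, Def. 3.1 (3.1)] -/
def basicCascadeForm (ε₀ : ℝ) (ψ₁ ψ₂ ψ₃ : 𝓢(ℝ³, ℝ³)) (u v w : L2C) : ℂ :=
  ∑' n : ℤ, (((1 + ε₀) ^ ((5 : ℝ) * (n : ℝ) / 2) : ℝ) : ℂ) *
    (pairing u (cascadeWavelet ε₀ ψ₁ n) * pairing v (cascadeWavelet ε₀ ψ₂ n) *
      pairing w (cascadeWavelet ε₀ ψ₃ n))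

/-- **Definition 3.1 (Local cascade operators)**, Tao 2016: the trilinear form `T = ⟨C(·,·), ·⟩`
of a bilinear operator `C : H¹⁰_df × H¹⁰_df → (H¹⁰_df)*` **is a local cascade operator with
dyadic scale parameter `ε₀`** if `C` is a finite (real) linear combination of basic local
cascade operators (3.1) whose profiles `ψ_{j,i}` are Schwartz with Fourier transforms supported
in the annulus `{1-2ε₀ ≤ |ξ| ≤ 1+2ε₀}`. The defining identity is recorded for `u, v ∈ H¹⁰_df`
and `w ∈ H¹⁰_df ⊗ ℂ` (see the module docstring: `ℂ`-linear extension in `w`). [cite: Tao2016AveragedNS, Def. 3.1] -/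
def IsLocalCascadeForm (ε₀ : ℝ) (T : L2C → L2C → L2C → ℂ) : Prop :=
  ∃ (k : ℕ) (c : Fin k → ℝ) (ψ : Fin k → Fin 3 → 𝓢(ℝ³, ℝ³)),
    (∀ j i, HasAnnularFourierSupport ε₀ (ψ j i)) ∧
      ∀ u v w, MemH10df u → MemH10df v → MemH10dfC w →
        T u v w = ∑ j, (c j : ℂ) * basicCascadeForm ε₀ (ψ j 0) (ψ j 1) (ψ j 2) u v w

/-! ### Sanity checks -/

/-- `⟨0, w⟩ = 0`. [folklore] -/
theorem pairing_zero_left (w : L2C) : pairing 0 w = 0 := by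
  simp [pairing, cdot]

/-- `⟨C(0,v), w⟩ = 0` for a basic local cascade form (every term of (3.1) vanishes). [folklore] -/
theorem basicCascadeForm_zero_left (ε₀ : ℝ) (ψ₁ ψ₂ ψ₃ : 𝓢(ℝ³, ℝ³)) (v w : L2C) :
    basicCascadeForm ε₀ ψ₁ ψ₂ ψ₃ 0 v w = 0 := by
  simp [basicCascadeForm, pairing_zero_left]

/-- **Non-vacuity of Definition 3.1 and of the solution notion**: the basic local cascade forms
are local cascade forms, and `u ≡ 0` is a global mild solution of `∂ₜu = Δu + C(u,u)` with
datum `0` for each of them (accepted `isMildSolutionFor_zero`). [folklore] -/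
theorem isLocalCascadeForm_basic {ε₀ : ℝ} {ψ₁ ψ₂ ψ₃ : 𝓢(ℝ³, ℝ³)}
    (h₁ : HasAnnularFourierSupport ε₀ ψ₁) (h₂ : HasAnnularFourierSupport ε₀ ψ₂)
    (h₃ : HasAnnularFourierSupport ε₀ ψ₃) :
    IsLocalCascadeForm ε₀ (basicCascadeForm ε₀ ψ₁ ψ₂ ψ₃) ∧
      IsMildSolutionFor (basicCascadeForm ε₀ ψ₁ ψ₂ ψ₃) 0 (Ici 0) (fun _ => 0) := by
  refine ⟨⟨1, fun _ => 1, fun _ => ![ψ₁, ψ₂, ψ₃], fun _ i => ?_, fun u v w _ _ _ => by simp⟩,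
    isMildSolutionFor_zero (basicCascadeForm_zero_left ε₀ ψ₁ ψ₂ ψ₃ 0) _⟩
  fin_cases i
  exacts [h₁, h₂, h₃]

/-! ### Theorems 3.2 and 3.3 -/

/-- **Tao 2016, Theorem 3.2 (Local cascade operators are averaged Euler operators)**, as
printed: *Let `ε₀ > 0` be a sufficiently small absolute constant. Then every local cascade
operator (with dyadic scale parameter `ε₀`) is an averaged Euler bilinear operator.* That is,
for some absolute `ε₁ > 0` and every `0 < ε₀ ≤ ε₁`: for every local cascade form `T` there is
an averaging datum `𝒜` (Tao (1.12)–(1.13), accepted `AveragingDatum`) with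
`⟨B̃_𝒜(u,v), w⟩ = ⟨C(u,v), w⟩`, recorded for `u, v ∈ H¹⁰_df` and `w ∈ H¹⁰_df ⊗ ℂ` (the
`ℂ`-linear extension in `w` of the printed identity of operators `H¹⁰_df × H¹⁰_df → (H¹⁰_df)*`;
see the module docstring). Proved in the source in §3.1–3.9 (complexification, frequency
localisation, extraction of the symbol, rotation averaging, and the non-degeneracy (3.24) of
the Euler symbol `Λ`); "the arguments are unrelated to those in the rest of the paper" (p. 14).
A `Prop`-valued definition, not asserted. [cite: Tao2016AveragedNS, Thm. 3.2] -/
def localCascade_isAveraged : Prop :=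
  ∃ ε₁ : ℝ, 0 < ε₁ ∧ ∀ ε₀ : ℝ, 0 < ε₀ → ε₀ ≤ ε₁ →
    ∀ T : L2C → L2C → L2C → ℂ, IsLocalCascadeForm ε₀ T →
      ∃ 𝒜 : AveragingDatum, ∀ u v w, MemH10df u → MemH10df v → MemH10dfC w →
        𝒜.form u v w = T u v w

/-- **Tao 2016, Theorem 3.3 (Blowup for a local cascade equation)**, as printed: *Let
`0 < ε₀ < 1`. Then there exists a symmetric local cascade operator
`C : H¹⁰_df(ℝ³) × H¹⁰_df(ℝ³) → H¹⁰_df(ℝ³)*` (with dyadic scale parameter `ε₀`) obeying the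
cancellation property (3.2) `⟨C(u,u), u⟩ = 0` for all `u ∈ H¹⁰_df(ℝ³)`, and Schwartz
divergence-free vector field `u₀`, such that there does not exist any global mild solution
`u : [0,+∞) → H¹⁰_df(ℝ³)` to the initial value problem (3.3) `∂ₜu = Δu + C(u,u)`, `u(0) = u₀`,
that is to say there does not exist any continuous `u : [0,+∞) → H¹⁰_df(ℝ³)` with
`u(t) = e^{tΔ}u₀ + ∫₀ᵗ e^{(t-t')Δ} C(u(t'),u(t')) dt'` for all `t ∈ [0,+∞)`* (accepted
`IsMildSolutionFor`). "The main technical result of this paper" (p. 14); proved in the source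
in §§4–6 from Lemma 4.1 and Theorem 4.2 (`odeBlowup`). A `Prop`-valued definition, not
asserted. [cite: Tao2016AveragedNS, Thm. 3.3] -/
def localCascade_blowup : Prop :=
  ∀ ε₀ : ℝ, 0 < ε₀ → ε₀ < 1 →
    ∃ T : L2C → L2C → L2C → ℂ, IsLocalCascadeForm ε₀ T ∧
      (∀ u v w, MemH10df u → MemH10df v → MemH10df w → T u v w = T v u w) ∧
      (∀ u, MemH10df u → T u u u = 0) ∧
        ∃ u₀ : 𝓢(ℝ³, ℝ³), VectorCalculus.IsDivFree ⇑u₀ ∧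
          ¬ ∃ u : ℝ → L2C, IsMildSolutionFor T (schwartzL2 u₀) (Ici 0) u

/-! ### Theorem 1.5 from Theorems 3.2 and 3.3 -/

/-- **Theorem 1.5 ⇐ Theorem 3.2 + Theorem 3.3** (Tao 2016, p. 14: "Theorem 1.5 is then an
immediate consequence of the following two results"). With `ε₀ = min ε₁ ½`, Theorem 3.3 gives
a symmetric local cascade form `T` with cancellation and a datum `u₀` without global mild
solution; Theorem 3.2 gives an averaging datum `𝒜` with `⟨B̃_𝒜(u,v), w⟩ = ⟨C(u,v), w⟩` for
`u, v ∈ H¹⁰_df`, `w ∈ H¹⁰_df ⊗ ℂ`. Then `B̃_𝒜` is symmetric with cancellation on `H¹⁰_df`, and a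
global mild solution for `B̃_𝒜` would be one for `C`: the Duhamel identities (1.15) and (3.3)
test the two forms on `(u(s), u(s), e^{(t-s)Δ} w)` with `u(s), w ∈ H¹⁰_df`, where they agree
(`e^{τΔ}` maps `H¹⁰_df` into `H¹⁰_df ⊗ ℂ`, `MemH10dfC.heat`). [cite: Tao2016AveragedNS, §3 p. 14] -/
theorem averagedNS_blowup_of_cascade (h32 : localCascade_isAveraged)
    (h33 : localCascade_blowup) : averagedNS_blowup := by
  obtain ⟨ε₁, hε₁, h32⟩ := h32
  have hε₀ : 0 < min ε₁ (1 / 2) := lt_min hε₁ (by norm_num)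
  have hε₀1 : min ε₁ (1 / 2) < 1 := (min_le_right _ _).trans_lt (by norm_num)
  obtain ⟨T, hT, hsymm, hcanc, u₀, hdiv, hno⟩ := h33 _ hε₀ hε₀1
  obtain ⟨𝒜, h𝒜⟩ := h32 _ hε₀ (min_le_left _ _) T hT
  refine ⟨𝒜, fun u v w hu hv hw => ?_, fun u hu => ?_, u₀, hdiv, ?_⟩
  · rw [h𝒜 u v w hu hv hw.memH10dfC, h𝒜 v u w hv hu hw.memH10dfC]
    exact hsymm u v w hu hv hw
  · rw [h𝒜 u u u hu hu hu.memH10dfC]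
    exact hcanc u hu
  · rintro ⟨u, hu⟩
    have hu' : IsMildSolutionFor 𝒜.form (schwartzL2 u₀) (Ici 0) u := hu
    refine hno ⟨u, hu'.1, hu'.2.1, fun t ht w hw => ?_⟩
    rw [hu'.2.2 t ht w hw]
    congr 1
    refine intervalIntegral.integral_congr fun s hs => ?_
    have hs0 : (0 : ℝ) ≤ s := by
      rw [Set.uIcc_of_le (show (0 : ℝ) ≤ t from ht)] at hs
      exact hs.1
    exact h𝒜 _ _ _ (hu'.1 s hs0) (hu'.1 s hs0) (hw.memH10dfC.heat _)

end Literature.Analysis.FluidPDE.Tao2016
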